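import Summits.QuantumFields.YangMills.Theorems.AlphaInputsT3ACAnnulusGapOfLetters
import Summits.QuantumFields.YangMills.Theorems.UnitScaleTiltHistoryTailAlphaTopQuarterScaled
import Summits.QuantumFields.YangMills.Theorems.UnitScaleTiltHistoryTailIntDataRows
import HarnessLib

/-!
# `AlphaInputsT3ACAnnulusGapOfB0` — THE (★3) PIN GAP FROM THE B0 LETTERS ALONE: ✓`AlphaInputsT3AC.PkgCoreRows.log_gap_le_of_letters` (the ONE NAME the (R7) docket cites,
# ✓p782692) WITH ITS LETTERS `hsf` ((71) at the scaled threshold) AND `hfac` (local-action factorisation) DISCHARGED BY NAME AT THE COMPOSITE MINIMISER — cell ym3-torus,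
# crux `HistoryTailL` (stmt-QuantumFields-19936), ★★OWNER g38 WORD №171 «(b1) hsf-DOCK»; seat ym-ust-19936-w8 g18; helper `--supports stmt-QuantumFields-19936`

WHAT.  §1 ★★★`AlphaInputsT3AC.log_gap_le_of_B0`: for a rows family `qf : ∀ K, PkgCoreRows F 𝔠 γ hγ hγ1 K` (the 19936 cone's currency, ✓`AlphaInputsT3AC.dataIntRows`), `K`, a level
`k ≤ K`, ANY measure `μ`, measurable `Ψ` into the level-`k` fields, weight `χ ≥ 0` supported in the (4)-window (`hsupp`), integrand `G ≥ 0` (`χ·G` integrable), in the (★1)-scaled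
γ-regime (`hθ1`, `hθ2` at `c = 1∕max(B₃,1)`; §0 ★`exists_gamma_quarter_regime_scaled` supplies both below a threshold `γ₁(L, b₀, p₀, C68, c)`): the LOCAL-UNDAMPING letter
`hund : ∫ χ·e^{loc_p(Ψ x)}·G ≤ Λund·b` — `loc_p(W) := β_K·Σ_{q : |q.src − toFine k p.src|_∞ ≤ 3(Lᵏ−1)} (1 − Re tr U_k(triv, W)(∂q))`, the fine Wilson action of the composite
minimiser `(qf K).UkH k triv W` localized under `p` (B0-class, px8 g17 letter 8538b781 ∕ RECORD 17ee `hund` 5ac39abd with `Gt_p := e^{loc_p}·G`, `ℓ_p := loc_p` SPELLED) — and the bulk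
`0 < b ≤ ∫ χ·𝟙[loPrintAC k](Ψ·)·G` ((58)) give RECORD 17ee's bill line
`log ∫χ·G ≤ log ∫χ·𝟙[loPrintAC k](Ψ·)·G + log(1 + |Plaq_k|·(e^{−(c²∕4)·p(g_{K−k})²}·Λund))`, `c = 1∕max(B₃,1)`.
§2 ★★★`log_gap_le_of_B0_chiB`: the same with `χ := χB_k(triv′) ∘ Ψ` — the registered rows' own small-field factor ([Balaban1985UV3] (49); tokens of ✓`PinnedStepChiClash` at the record
instance) — where `hsupp` is DISCHARGED (`Ω_{k+1}(triv′) = T`: ✓`Carriers.Omega_triv`, ✓`PkgCoreRows.eps1_eq`); residual display {`hθ1`, `hθ2`, `hintU`, `hund`, `hb`, `hb₁`} + parameters.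

HOW (no new analysis).  `hsf` ⟸ ✓`HistoryTailAlphaTopQuarterScaled.quarter_pFun_sq_le_localAction_scaled` ((71) at `c·θBal`, ✓p782167) over the datum ✓`dataIntRows qf π` (any `π`; its
minimiser∕regions∕admissibility fields are `π`-free) with ✓`dataIntRows_constraint42Top` ((42)∕(67)), ✓`dataIntRows_regularity68Levels` ((68)), ✓`dataIntRows_admOnSmall` ((40): the
window datum is admissible at `triv`), `hΩ` by ✓`Omega_triv`, then `Σ_{R₀} ≤ Σ_{box}` (✓`GaugeGroup.reTr_le_one`, ✓`T3Family.scheme_β_nonneg`); `hfac` ⟸ the pin spelling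
`Gt_p := e^{ℓ_p}·G` (px8 g17 `HfacPinIdentity` 9527b45f: one `rw`), with the support-aware `ℓ_p x := loc_p(Ψ x)` on `{χ ≠ 0}` (and `:= E` off it, where both sides of every letter vanish).

HONEST SCOPE.  Bookkeeping over landed helpers ([folklore] + the cited rows BY NAME); `hund`, `hintU`, `b`, `hθ1`∕`hθ2`, `ha₁` are HYPOTHESES; no (58) value, no `r_k` row text,
no B0 definition, no registry byte (`unbundled_v6` fc7786ec untouched, J-FREEZE); (R7a)∕(R7b)-agnostic; nothing of [Balaban1985UV3] asserted beyond the cited tree rows; (★3)'s B0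
content, #22∕#23, (O‴χₛ), `HistoryTailL` (19936), EX, 19200, 20520, `YM3TorusSU2` NOT proved; def-free; count-neutral.  Rung R3 = SU(2) YM₃ on T³ — not d = 4, not infinite
volume, not a mass gap, not Clay; the Yang–Mills mass gap is NOT proved.
References: T. Bałaban, Commun. Math. Phys. 102 (1985) 255–275 [Balaban1985UV3] ((7) p.257, (40)–(42) p.266, (49) p.268, (58) p.270, (67)–(71) p.273); 102 (1985) 277–309
[Balaban1985Variational] (Thm 1 (8) p.279).
-/

set_option autoImplicit false

noncomputable section

open scoped BigOperators

namespace Summit.QuantumFields.YangMills.Theorems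

open MeasureTheory Literature.MathematicalPhysics.QuantumFieldTheory.Balaban1983to89
open Literature.MathematicalPhysics.QuantumFieldTheory.Balaban1983to89.T3ContinuumYM3Torus
open Literature.MathematicalPhysics.QuantumFieldTheory.Balaban1983to89.T3UnitLawDensityEML (ℰp)
open Literature.MathematicalPhysics.QuantumFieldTheory.Balaban1983to89.T3UnitScaleTilt (θBal)
open Literature.MathematicalPhysics.QuantumFieldTheory.Balaban1983to89.T3AlphaInputsAC
open Literature.MathematicalPhysics.QuantumFieldTheory.Balaban1983to89.B10Eq38TorusDomains (toFine)
open Literature.MathematicalPhysics.QuantumFieldTheory.Balaban1985CMP102 Literature.MathematicalPhysics.QuantumFieldTheory.Balaban1985CMP102.Setting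
open Summit.QuantumFields.Balaban3D.Carriers
open Summit.QuantumFields.Balaban3D.Proofs.Primitives
open Summit.QuantumFields.Balaban3D.Proofs.TowerAC Summit.QuantumFields.Balaban3D.Proofs.StandardAC Summit.QuantumFields.Balaban3D.Proofs.InputsAC
open Summit.QuantumFields.YangMills.Theorems.HistoryTailAlphaTopQuarterScaled (quarter_pFun_sq_le_localAction_scaled)
open Summit.QuantumFields.YangMills.Theorems.HistoryTailAlphaTopQuarter (exists_gamma_quarter_regime)
open Summit.QuantumFields.Balaban3D.Proofs.Bound55Masses (chiB chiB_nonneg measurable_chiB)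

variable {F : T3Family} {𝔠 : AlphaConsts F.L (suGroupModel 2).N} {γ : ℝ} {hγ : 0 < γ} {hγ1 : γ ≤ (min 𝔠.gamma0 1) ^ 2}


namespace AlphaInputsT3AC

/-! ## §0 The (★1)-scaled γ-regime: the side conditions `hθ1`, `hθ2` at `0 < c ≤ 1` below a coupling threshold `γ₁(L, b₀, p₀, C68, c)` -/

/-- **THE SCALED QUARTER REGIME** — the `c`-parametric twin of ✓`HistoryTailAlphaTopQuarter.exists_gamma_quarter_regime` (read at `C68 ↦ C68∕c`): for `0 < c ≤ 1`
there is `0 < γ₁ ≤ 1` such that for every `0 < γ ≤ γ₁` and all `K, j` the local-Stokes side condition `hθ1` holds and the remainder side condition holds in the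
`c²`-strengthened form `… ≤ c²∕4` of ✓`quarter_pFun_sq_le_localAction_scaled`.  (The threshold depends on `B₃` through `c = 1∕max(B₃,1)` — ★★OWNER g37 WORD №143's
price of record.) [cite: Balaban1985UV3, (7) p.257 and (67)-(71) p.273] -/
theorem exists_gamma_quarter_regime_scaled (F : T3Family) {b₀ p₀ : ℝ} (hb : 0 < b₀) (hp : 0 < p₀) {C68 : ℝ} (hC68 : 0 ≤ C68)
    {c : ℝ} (hc : 0 < c) (hc1 : c ≤ 1) :
    ∃ γ₁ : ℝ, 0 < γ₁ ∧ γ₁ ≤ 1 ∧ ∀ γ : ℝ, 0 < γ → γ ≤ γ₁ → ∀ K j : ℕ,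
      ((((3 + 2) * F.L : ℕ) : ℝ) ^ 2 / 4) * (C68 * θBal F.L γ b₀ p₀ (K - j)) ≤ 1 / 10 ∧
      540 * (435 ^ 2 * (C68 * (((3 + 2) * F.L : ℕ) : ℝ) ^ 2 / 4) ^ 4) * θBal F.L γ b₀ p₀ (K - j) ^ 2 ≤ c ^ 2 / 4 := by
  obtain ⟨γ₁, hγ₁, hγ₁1, hreg⟩ := exists_gamma_quarter_regime F hb hp (div_nonneg hC68 hc.le : 0 ≤ C68 / c)
  refine ⟨γ₁, hγ₁, hγ₁1, fun γ hγ hγle K j => ?_⟩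
  obtain ⟨h1, h2⟩ := hreg γ hγ hγle K j
  have hθ : 0 ≤ θBal F.L γ b₀ p₀ (K - j) :=
    (T3MinimiserStabilityReduction.θBal_pos (le_of_lt F.hL.2) hγ (hγle.trans hγ₁1) hb p₀ (K - j)).le
  have hX : (0 : ℝ) ≤ (((3 + 2) * F.L : ℕ) : ℝ) ^ 2 / 4 := by positivity
  have hCc : C68 ≤ C68 / c := by rw [le_div_iff₀ hc]; nlinarith
  refine ⟨le_trans (mul_le_mul_of_nonneg_left (mul_le_mul_of_nonneg_right hCc hθ) hX) h1, ?_⟩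
  set M : ℝ := 540 * (435 ^ 2 * (C68 * (((3 + 2) * F.L : ℕ) : ℝ) ^ 2 / 4) ^ 4) * θBal F.L γ b₀ p₀ (K - j) ^ 2 with hM
  have hM0 : 0 ≤ M := by positivity
  have e : 540 * (435 ^ 2 * (C68 / c * (((3 + 2) * F.L : ℕ) : ℝ) ^ 2 / 4) ^ 4) * θBal F.L γ b₀ p₀ (K - j) ^ 2 = M / c ^ 4 := by
    rw [hM]; field_simp
  rw [e, div_le_iff₀ (by positivity)] at h2
  have hc2 : c ^ 2 ≤ 1 := by nlinarith
  have hc4 : c ^ 4 ≤ c ^ 2 := by nlinarith [sq_nonneg c]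
  nlinarith

/-! ## §1 The knit through ✓`PkgCoreRows.log_gap_le_of_letters`: `hsf` and `hfac` discharged at the composite minimiser -/

open Classical in
/-- ★★★ **THE (★3) GAP FROM THE B0 LETTERS ALONE** (`hsf`, `hfac` of ✓`PkgCoreRows.log_gap_le_of_letters` discharged at the composite minimiser of a rows family `qf`).
For `K`, a level `k ≤ K`, any measure `μ`, measurable `Ψ` into the level-`k` fields, weight `χ ≥ 0` SUPPORTED IN THE (4)-WINDOW (`hsupp`: `χ x ≠ 0 ⇒ |Ψ x(∂p) − 1| < θBal(K−k)`,
the (40) support of `χB_k(triv′)`, ✓`plaqSmall_of_chiB_triv_ne_zero`), integrand `G ≥ 0` with `χ·G` integrable, in the (★1)-scaled γ-regime (`hθ1`, `hθ2` at `c = 1∕max(B₃,1)`):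
the LOCAL-UNDAMPING letter `hund` — `∫ χ·e^{loc_p(Ψ x)}·G ≤ Λund·b` with `loc_p(W) := β_K·Σ_{q : |q.src − toFine k p.src|_∞ ≤ 3(Lᵏ−1)} (1 − Re tr U_k(triv,W)(∂q))` the fine Wilson
action of the composite minimiser localized under `p` — and the bulk `0 < b ≤ ∫χ·𝟙[loPrintAC k](Ψ·)·G` give
`log ∫χ·G ≤ log ∫χ·𝟙[loPrintAC k](Ψ·)·G + log(1 + |Plaq_k|·(e^{−(c²∕4)p(g_{K−k})²}·Λund))`, `c = 1∕max(B₃,1)`. [cite: Balaban1985UV3, (67)-(71) p.273] -/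
theorem log_gap_le_of_B0 (qf : ∀ K, AlphaInputsT3AC.PkgCoreRows F 𝔠 γ hγ hγ1 K) (K : ℕ)
    (ha₁ : ∀ i, θBal F.L γ 𝔠.b₀ 𝔠.p₀ i ≤ (qf K).a₁) (k : ℕ) (hk : k ≤ K)
    (hθ1 : ((((3 + 2) * F.L : ℕ) : ℝ) ^ 2 / 4) * (𝔠.C68 * θBal F.L γ 𝔠.b₀ 𝔠.p₀ (K - k)) ≤ 1 / 10)
    (hθ2 : 540 * (435 ^ 2 * (𝔠.C68 * (((3 + 2) * F.L : ℕ) : ℝ) ^ 2 / 4) ^ 4) * θBal F.L γ 𝔠.b₀ 𝔠.p₀ (K - k) ^ 2 ≤ (1 / max 𝔠.B₃ 1) ^ 2 / 4)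
    {β : Type*} [MeasurableSpace β] (μ : Measure β)
    (Ψ : β → GaugeField (F.P K) k (Matrix.specialUnitaryGroup (Fin 2) ℂ)) (hΨ : Measurable Ψ)
    {χ G : β → ℝ} (hχ : ∀ x, 0 ≤ χ x) (hG : ∀ x, 0 ≤ G x) (hint : Integrable (fun x => χ x * G x) μ)
    (hsupp : ∀ x, χ x ≠ 0 → PlaqSmall (θBal F.L γ 𝔠.b₀ 𝔠.p₀ (K - k)) (Ψ x))
    {Λund b : ℝ}
    (hintU : ∀ p : Plaq (F.P K) k, Integrable (fun x => χ x *
      (Real.exp ((F.scheme ℰp γ).β K *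
          ∑ q ∈ Finset.univ.filter (fun q : Plaq (F.P K) 0 => ∀ ι, ∃ e : ℤ, |e| ≤ 3 * (((F.P K).L : ℤ) ^ k - 1) ∧
            q.src ι = toFine k p.src ι + (e : ZMod ((F.P K).sitesPerDir 0))),
            (1 - reTr (GaugeField.plaqHol ((qf K).UkH k (Hist.triv (F.P K) k) (Ψ x)) q))) * G x)) μ)
    (hund : ∀ p : Plaq (F.P K) k, ∫ x, χ x *
      (Real.exp ((F.scheme ℰp γ).β K *
          ∑ q ∈ Finset.univ.filter (fun q : Plaq (F.P K) 0 => ∀ ι, ∃ e : ℤ, |e| ≤ 3 * (((F.P K).L : ℤ) ^ k - 1) ∧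
            q.src ι = toFine k p.src ι + (e : ZMod ((F.P K).sitesPerDir 0))),
            (1 - reTr (GaugeField.plaqHol ((qf K).UkH k (Hist.triv (F.P K) k) (Ψ x)) q))) * G x) ∂μ ≤ Λund * b)
    (hb : 0 < b) (hb₁ : b ≤ ∫ x, χ x * (PinnedStep.loPrintAC 𝔠.lane (qf K).X k).indicator (fun _ => (1 : ℝ)) (Ψ x) * G x ∂μ) :
    Real.log (∫ x, χ x * G x ∂μ) ≤
      Real.log (∫ x, χ x * (PinnedStep.loPrintAC 𝔠.lane (qf K).X k).indicator (fun _ => (1 : ℝ)) (Ψ x) * G x ∂μ)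
        + Real.log (1 + (Fintype.card (Plaq (F.P K) k) : ℝ) *
          (Real.exp (-(((1 / max 𝔠.B₃ 1) ^ 2 / 4) * B10.pFun 𝔠.b₀ 𝔠.p₀ (Real.sqrt (γ * ((F.L : ℝ)⁻¹) ^ (K - k))) ^ 2)) * Λund)) := by
  classical
  -- the dummy polymer parameter and the rows-family datum (its minimiser∕regions∕admissibility fields are `π`-free)
  let π : AlphaInputsT3AC.PolymerT3 F := ⟨fun _ _ _ _ => ∅, fun _ _ _ _ => 0, fun _ _ Y => Y, fun _ _ _ => 0⟩
  set D : AlphaDataT3 F γ := AlphaInputsT3AC.dataIntRows qf π with hD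
  have hγ1' : γ ≤ 1 := hγ1.trans (sq_min_one_le _ 𝔠.gamma0_pos)
  set c : ℝ := 1 / max 𝔠.B₃ 1 with hc
  have hc0 : 0 < c := by rw [hc]; positivity
  set E : ℝ := (c ^ 2 / 4) * B10.pFun 𝔠.b₀ 𝔠.p₀ (Real.sqrt (γ * ((F.L : ℝ)⁻¹) ^ (K - k))) ^ 2 with hE
  -- the local action under `p` at the composite minimiser
  set Box : Plaq (F.P K) k → Finset (Plaq (F.P K) 0) := fun p =>
    Finset.univ.filter (fun q : Plaq (F.P K) 0 => ∀ ι, ∃ e : ℤ, |e| ≤ 3 * (((F.P K).L : ℤ) ^ k - 1) ∧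
      q.src ι = toFine k p.src ι + (e : ZMod ((F.P K).sitesPerDir 0))) with hBox
  set loc : Plaq (F.P K) k → GaugeField (F.P K) k (Matrix.specialUnitaryGroup (Fin 2) ℂ) → ℝ := fun p W =>
    (F.scheme ℰp γ).β K * ∑ q ∈ Box p, (1 - reTr (GaugeField.plaqHol ((qf K).UkH k (Hist.triv (F.P K) k) W) q)) with hloc
  -- (71) at the scaled threshold for a window datum with a `p`-annulus plaquette: `E ≤ loc_p`
  have hsf0 : ∀ (p : Plaq (F.P K) k) (W : GaugeField (F.P K) k (Matrix.specialUnitaryGroup (Fin 2) ℂ)),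
      PlaqSmall (θBal F.L γ 𝔠.b₀ 𝔠.p₀ (K - k)) W →
      θBal F.L γ 𝔠.b₀ 𝔠.p₀ (K - k) / max 𝔠.B₃ 1 ≤ GaugeGroup.dist1 (GaugeField.plaqHol W p) → E ≤ loc p W := by
    intro p W hW hlarge
    have hadm : D.Adm K k (D.triv K k) W := AlphaInputsT3AC.dataIntRows_admOnSmall qf π K k W hk hW
    have hΩ : {x : Site (F.P K) 0 | ∀ ι, ∃ e : ℤ, |e| ≤ 8 * ((F.P K).L : ℤ) ^ k ∧
        x ι = toFine k p.src ι + (e : ZMod ((F.P K).sitesPerDir 0))} ⊆ D.Ω K k (D.triv K k) k := by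
      intro x _
      show x ∈ Omega 𝔠.lane.carrier.M₁
        (rcolOf (T3Scales F γ hγ (hγ1.trans (sq_min_one_le _ 𝔠.gamma0_pos)) K) 𝔠.lane.carrier) k (Hist.triv (F.P K) k) k
      rw [Omega_triv]; exact Set.mem_univ _
    have hlarge' : c * θBal F.L γ 𝔠.b₀ 𝔠.p₀ (K - k) ≤ GaugeGroup.dist1 (GaugeField.plaqHol W p) := by
      rw [hc, one_div_mul_eq_div]; exact hlarge
    obtain ⟨R₀, hR₀, hq⟩ := quarter_pFun_sq_le_localAction_scaled (D := D) hγ hγ1' 𝔠.b₀_pos.le 𝔠.p₀ 𝔠.C68_pos.le hc0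
      (AlphaInputsT3AC.dataIntRows_constraint42Top qf π) (AlphaInputsT3AC.dataIntRows_regularity68Levels qf π)
      hk (D.triv K k) W hadm p hΩ hlarge' hθ1 (by rw [hc] at hθ2 ⊢; exact hθ2)
    have hsub : R₀ ⊆ Box p := fun q hq' => by
      rw [hBox]; exact Finset.mem_filter.mpr ⟨Finset.mem_univ _, hR₀ q hq'⟩
    have hβ0 : 0 ≤ (F.scheme ℰp γ).β K := F.scheme_β_nonneg ℰp hγ.le K
    have hT0 : ∀ q : Plaq (F.P K) 0, 0 ≤ 1 - reTr (GaugeField.plaqHol ((qf K).UkH k (Hist.triv (F.P K) k) W) q) := fun q => by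
      have := GaugeGroup.reTr_le_one (GaugeField.plaqHol ((qf K).UkH k (Hist.triv (F.P K) k) W) q); linarith
    calc E ≤ (F.scheme ℰp γ).β K * ∑ q ∈ R₀, (1 - reTr (GaugeField.plaqHol (D.Umin K k (D.triv K k) W) q)) := hq
      _ ≤ (F.scheme ℰp γ).β K * ∑ q ∈ Box p, (1 - reTr (GaugeField.plaqHol ((qf K).UkH k (Hist.triv (F.P K) k) W) q)) :=
          mul_le_mul_of_nonneg_left (Finset.sum_le_sum_of_subset_of_nonneg hsub fun q _ _ => hT0 q) hβ0
      _ = loc p W := rfl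
  -- the pin spelling of `ℓ`, `Gt` (support-aware)
  set ℓ : Plaq (F.P K) k → β → ℝ := fun p x => if χ x = 0 then E else loc p (Ψ x) with hℓ
  set Gt : Plaq (F.P K) k → β → ℝ := fun p x => Real.exp (ℓ p x) * G x with hGt
  have hGt0 : ∀ p x, 0 ≤ Gt p x := fun p x => mul_nonneg (Real.exp_pos _).le (hG x)
  have hfac : ∀ p x, G x = Real.exp (-(ℓ p x)) * Gt p x := fun p x => by
    rw [hGt]; simp only []
    rw [← mul_assoc, ← Real.exp_add, neg_add_cancel, Real.exp_zero, one_mul]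
  have hagree : ∀ p x, χ x * Gt p x = χ x * (Real.exp (loc p (Ψ x)) * G x) := fun p x => by
    by_cases hx : χ x = 0
    · rw [hx, zero_mul, zero_mul]
    · rw [hGt, hℓ]; simp only [if_neg hx]
  have hintp : ∀ p, Integrable (fun x => χ x * Gt p x) μ := fun p =>
    (hintU p).congr (ae_of_all _ fun x => (hagree p x).symm)
  have hsf : ∀ p x, Ψ x ∈ {U : GaugeField (F.P K) k (Matrix.specialUnitaryGroup (Fin 2) ℂ) |
      θBal F.L γ 𝔠.b₀ 𝔠.p₀ (K - k) / max 𝔠.B₃ 1 ≤ GaugeGroup.dist1 (GaugeField.plaqHol U p)} → E ≤ ℓ p x := by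
    intro p x hx
    by_cases h0 : χ x = 0
    · rw [hℓ]; simp only [if_pos h0]; exact le_rfl
    · rw [hℓ]; simp only [if_neg h0]; exact hsf0 p (Ψ x) (hsupp x h0) hx
  have hund' : ∀ p, ∫ x, χ x * Gt p x ∂μ ≤ Λund * b := fun p => by
    rw [integral_congr_ae (ae_of_all _ fun x => hagree p x)]; exact hund p
  have h := (qf K).log_gap_le_of_letters ha₁ k hk μ Ψ hΨ hχ hG hint Gt ℓ hGt0 hfac hintp hsf hund' hb hb₁
  rw [hE] at h
  exact h


/-! ## §2 The pin's own small-field factor `χ := χB_k(triv′) ∘ Ψ`: the support letter discharged -/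

open Classical in
/-- ★★★ **THE (★3) GAP AT THE PIN'S SMALL-FIELD FACTOR** — §1 with the weight PINNED to the registered rows' `χB_k(triv′)` ([Balaban1985UV3] (49) p.268; the tokens of
✓`PinnedStepChiClash`∕✓`Fibre55WinAC` at the record instance `𝔎 := 𝔠.lane`, `S := T3Scales …`) composed with the measurable field map `Ψ` (`U(V, A′)` in (55)): the support letter
`hsupp` is ✓`plaqSmall_of_chiB_triv_ne_zero` ∘ ✓`PkgCoreRows.eps1_eq`, `0 ≤ χ` is ✓`chiB_nonneg`.  Residual display: {`hθ1`, `hθ2` (§0-fed), `hintU`, `hund`, `hb`, `hb₁`} + parameters.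
[cite: Balaban1985UV3, (49) p.268 and (67)-(71) p.273] -/
theorem log_gap_le_of_B0_chiB (qf : ∀ K, AlphaInputsT3AC.PkgCoreRows F 𝔠 γ hγ hγ1 K) (K : ℕ)
    (ha₁ : ∀ i, θBal F.L γ 𝔠.b₀ 𝔠.p₀ i ≤ (qf K).a₁) (k : ℕ) (hk : k ≤ K)
    (hθ1 : ((((3 + 2) * F.L : ℕ) : ℝ) ^ 2 / 4) * (𝔠.C68 * θBal F.L γ 𝔠.b₀ 𝔠.p₀ (K - k)) ≤ 1 / 10)
    (hθ2 : 540 * (435 ^ 2 * (𝔠.C68 * (((3 + 2) * F.L : ℕ) : ℝ) ^ 2 / 4) ^ 4) * θBal F.L γ 𝔠.b₀ 𝔠.p₀ (K - k) ^ 2 ≤ (1 / max 𝔠.B₃ 1) ^ 2 / 4)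
    {β : Type*} [MeasurableSpace β] (μ : Measure β)
    (Ψ : β → GaugeField (F.P K) k (Matrix.specialUnitaryGroup (Fin 2) ℂ)) (hΨ : Measurable Ψ)
    {G : β → ℝ} (hG : ∀ x, 0 ≤ G x)
    (hint : Integrable (fun x =>
      chiB 𝔠.lane.carrier.M₁ (rcolOf (T3Scales F γ hγ (hγ1.trans (sq_min_one_le _ 𝔠.gamma0_pos)) K) 𝔠.lane.carrier)
        (eps1Of (T3Scales F γ hγ (hγ1.trans (sq_min_one_le _ 𝔠.gamma0_pos)) K) 𝔠.lane.carrier) k (Hist.triv (F.P K) (k + 1)) (Ψ x) * G x) μ)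
    {Λund b : ℝ}
    (hintU : ∀ p : Plaq (F.P K) k, Integrable (fun x =>
      chiB 𝔠.lane.carrier.M₁ (rcolOf (T3Scales F γ hγ (hγ1.trans (sq_min_one_le _ 𝔠.gamma0_pos)) K) 𝔠.lane.carrier)
        (eps1Of (T3Scales F γ hγ (hγ1.trans (sq_min_one_le _ 𝔠.gamma0_pos)) K) 𝔠.lane.carrier) k (Hist.triv (F.P K) (k + 1)) (Ψ x) *
      (Real.exp ((F.scheme ℰp γ).β K *
          ∑ q ∈ Finset.univ.filter (fun q : Plaq (F.P K) 0 => ∀ ι, ∃ e : ℤ, |e| ≤ 3 * (((F.P K).L : ℤ) ^ k - 1) ∧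
            q.src ι = toFine k p.src ι + (e : ZMod ((F.P K).sitesPerDir 0))),
            (1 - reTr (GaugeField.plaqHol ((qf K).UkH k (Hist.triv (F.P K) k) (Ψ x)) q))) * G x)) μ)
    (hund : ∀ p : Plaq (F.P K) k, ∫ x,
      chiB 𝔠.lane.carrier.M₁ (rcolOf (T3Scales F γ hγ (hγ1.trans (sq_min_one_le _ 𝔠.gamma0_pos)) K) 𝔠.lane.carrier)
        (eps1Of (T3Scales F γ hγ (hγ1.trans (sq_min_one_le _ 𝔠.gamma0_pos)) K) 𝔠.lane.carrier) k (Hist.triv (F.P K) (k + 1)) (Ψ x) *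
      (Real.exp ((F.scheme ℰp γ).β K *
          ∑ q ∈ Finset.univ.filter (fun q : Plaq (F.P K) 0 => ∀ ι, ∃ e : ℤ, |e| ≤ 3 * (((F.P K).L : ℤ) ^ k - 1) ∧
            q.src ι = toFine k p.src ι + (e : ZMod ((F.P K).sitesPerDir 0))),
            (1 - reTr (GaugeField.plaqHol ((qf K).UkH k (Hist.triv (F.P K) k) (Ψ x)) q))) * G x) ∂μ ≤ Λund * b)
    (hb : 0 < b)
    (hb₁ : b ≤ ∫ x,
      chiB 𝔠.lane.carrier.M₁ (rcolOf (T3Scales F γ hγ (hγ1.trans (sq_min_one_le _ 𝔠.gamma0_pos)) K) 𝔠.lane.carrier)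
        (eps1Of (T3Scales F γ hγ (hγ1.trans (sq_min_one_le _ 𝔠.gamma0_pos)) K) 𝔠.lane.carrier) k (Hist.triv (F.P K) (k + 1)) (Ψ x) *
      (PinnedStep.loPrintAC 𝔠.lane (qf K).X k).indicator (fun _ => (1 : ℝ)) (Ψ x) * G x ∂μ) :
    Real.log (∫ x,
      chiB 𝔠.lane.carrier.M₁ (rcolOf (T3Scales F γ hγ (hγ1.trans (sq_min_one_le _ 𝔠.gamma0_pos)) K) 𝔠.lane.carrier)
        (eps1Of (T3Scales F γ hγ (hγ1.trans (sq_min_one_le _ 𝔠.gamma0_pos)) K) 𝔠.lane.carrier) k (Hist.triv (F.P K) (k + 1)) (Ψ x) * G x ∂μ) ≤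
      Real.log (∫ x,
        chiB 𝔠.lane.carrier.M₁ (rcolOf (T3Scales F γ hγ (hγ1.trans (sq_min_one_le _ 𝔠.gamma0_pos)) K) 𝔠.lane.carrier)
          (eps1Of (T3Scales F γ hγ (hγ1.trans (sq_min_one_le _ 𝔠.gamma0_pos)) K) 𝔠.lane.carrier) k (Hist.triv (F.P K) (k + 1)) (Ψ x) *
        (PinnedStep.loPrintAC 𝔠.lane (qf K).X k).indicator (fun _ => (1 : ℝ)) (Ψ x) * G x ∂μ)
        + Real.log (1 + (Fintype.card (Plaq (F.P K) k) : ℝ) *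
          (Real.exp (-(((1 / max 𝔠.B₃ 1) ^ 2 / 4) * B10.pFun 𝔠.b₀ 𝔠.p₀ (Real.sqrt (γ * ((F.L : ℝ)⁻¹) ^ (K - k))) ^ 2)) * Λund)) := by
  have heps : eps1Of (T3Scales F γ hγ (hγ1.trans (sq_min_one_le _ 𝔠.gamma0_pos)) K) 𝔠.lane.carrier k = θBal F.L γ 𝔠.b₀ 𝔠.p₀ (K - k) :=
    (qf K).eps1_eq k hk
  refine log_gap_le_of_B0 qf K ha₁ k hk hθ1 hθ2 μ Ψ hΨ (fun x => chiB_nonneg _ _ _ k _ _) hG hint (fun x hx => ?_) hintU hund hb hb₁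
  -- `χB_k(triv′)(Ψ x) ≠ 0 ⇒ |Ψ x(∂p) − 1| < ε₁(k)` for ALL `p` (`Ω_{k+1}(triv′) = T`, no large-field plaquettes; ✓`WindowStep.plaqSmall_of_chiB_triv_ne_zero`'s proof)
  rw [← heps]
  unfold chiB at hx
  split_ifs at hx with hcond
  · exact fun p => hcond p (by simp) (by rw [Omega_triv]; exact Set.subset_univ _)
  · exact absurd rfl hx

end AlphaInputsT3AC

end Summit.QuantumFields.YangMills.Theorems

end
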